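import Literature.AlgebraicGeometry.HodgeTheory.RealMultiplicationDivisorClasses
import Literature.AlgebraicGeometry.Motives.HodgeLieSymplecticBlocksRankFour
import Literature.AlgebraicGeometry.Milne1999.SpecialLefschetzGroupInvariantsImaginaryQuadratic
import HarnessLib

/-!
# Hodge-adapted symplectic bases of the four-dimensional eigenblocks of an abelian variety with real multiplication of relative dimension two, and their symplectic classes `b_τ 0 ⌣ b_τ 2 + b_τ 1 ⌣ b_τ 3 ∈ B¹(A) ⊗ ℂ` (Murty 1984 §3 / Milne 1999 Prop. 3.6 (a): the degree-two invariants `ω_τ ∈ Λ² V_τ` of `⊕_τ Sp(V_τ)` are divisor classes) — the cycle side of the type I(2) row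

Family `hodge`, layer `Literature/AlgebraicGeometry/HodgeTheory`. Research context: cell `pub-hodge-ring2`
(HONEST FRAMING: research route conditional on HC_CM; not a corollary; Q11.4-sentence-2 already refuted in
dim ≥ 3), Literature lane gen 70, programme R47 «type I(2) row of the row-four residual», the CYCLE side
(sequel of the Lie side `RealMultiplicationRelDimTwoPowersLieInvariance`): the relative-dimension-TWO analogue of
the tree's `RealMultiplicationDivisorClasses` (relative dimension one, `θ_τ = b_τ 0 ⌣ b_τ 1`). THEOREMS ONLY
(no definition, no named fact; D-0026); UNCONDITIONAL; no step towards a summit statement.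

PUBLISHED STATEMENTS. Murty 1984 §3 (Gordon 1997 §7.7, Prop. 7.7.1): for type (I) the factors of the Lefschetz
group `Lf(A)_ℝ`, indexed by the real places `τ` of `F = End⁰(A)`, are the symplectic groups `Sp(V_τ, ψ_τ)` in
their standard representation, and `H*(A^k, ℚ)^{Lf(A)} = Div(A^k)`; Milne 1999 Prop. 3.6 (a) (p. 655) with
p. 654 «for even `m`, `(H^{⊗m})^G` is generated as a `k[S_m]`-algebra by `φ ⊗ ⋯ ⊗ φ`» and Cor. 4.5: the
degree-two invariants `φ_τ ∈ Λ² V_τ` are Lefschetz (divisor) classes. Deligne LNM 900 §4 (proof of Cor. 4.2)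
and Lange 2023 Lemma 7.3.7: a non-degenerate alternating form with a pair of transverse Lagrangians has a
symplectic basis adapted to them (the tree's `Milne1999.exists_adapted_symplecticBasis`).

SETTING. `A` a complex abelian variety with `End⁰(A) = F` a totally real field; `ψ` a polarization of
`H = H¹(A(ℂ); ℚ)`; `V_τ ⊆ H ⊗ ℂ` the joint eigenspaces of `F` (`τ : F → ℂ`); for relative dimension two
(`2[F:ℚ] = dim A`) they are four-dimensional (`finrank_eigenBlock_hodgeCharacter_eq_four`). A HODGE–DARBOUX
block basis is `b_τ : Fin 4 → V_τ` with `b_τ 0, b_τ 1 ∈ H^{1,0}`, `b_τ 2, b_τ 3 ∈ H^{0,1}` and Gram matrix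
`ψ_ℂ(b_τ a, b_τ c) = G_{ac}`, `G = ( 0 I ; -I 0 )` (`ψ_ℂ(b_τ 0, b_τ 2) = ψ_ℂ(b_τ 1, b_τ 3) = 1`, the other
pairings of distinct indices in `{0,1} × {2,3}` and inside `{0,1}`, `{2,3}` vanish).

MAIN RESULTS (all proved).
* §1 `HodgeStructure.exists_hodgeDarboux_blockBasis_four` (abstract weight-one polarized `ℚ`-Hodge structures
  with `End_Hdg` self-adjoint and four-dimensional eigenblocks: Hodge–Darboux block bases exist — Deligne's
  construction with `J = Θ|_{V_τ}`, the two Lagrangians `V_τ ∩ H^{1,0}`, `V_τ ∩ H^{0,1}`).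
* §2 (the `ψ`-Casimir classes, four-dimensional blocks) `hodgeCharacter_injective`,
  `casimirClass_eq_sum_dualFamily` (ANY block size: the Casimir class `Λ(Y) = ∑_i ρ(Y d_i) ⌣ ρ(e_i)` computed in a
  block family and its blockwise `ψ_ℂ`-dual family), `casimirClass_eq_sum_blocks_darboux`
  (`Λ(Y) = ∑_τ [ρ(Y b_τ0) ⌣ ρ(b_τ2) − ρ(Y b_τ2) ⌣ ρ(b_τ0) + ρ(Y b_τ1) ⌣ ρ(b_τ3) − ρ(Y b_τ3) ⌣ ρ(b_τ1)]`),
  `blockScalar_mem_span_endAlg` (an operator acting on every block by a scalar lies in `End_Hdg ⊗ ℂ`),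
  `exists_blockProjector`, and **`thetaFour_mem_span_rational_oneOne`**: `ρ(b_τ 0) ⌣ ρ(b_τ 2) + ρ(b_τ 1) ⌣ ρ(b_τ 3)`
  is a `ℂ`-combination of RATIONAL `(1,1)`-classes of `A` (`= ½ Λ(p_τ)`, `p_τ` the block projector).
* §3 `rm4Letters_cross_mem_span_rational_oneOne` (crossed classes of two slots at the same place lie in
  `D¹(B) ⊗ ℂ`) and `sum_gramInv_smul_cup_rm4Letters_mem` — the HYPOTHESIS `hcross` of the tree's several-blocks
  divisor criterion `Milne1999.mem_divisorClassesSpan_of_forall_exteriorPullback_eq_of_spBlocks` for the letters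
  `g_j^* b_τ a` of an abelian variety `B` with slots over `A`, with `Ω_τ = G` for every `τ`
  (`gramFour_inv : G⁻¹ = -G`).

## References

* [Murty1984] V. K. Murty, *Exceptional Hodge classes on certain abelian varieties*, Math. Ann. 268 (1984)
  197–206, §3. [cite: Murty1984, §3]
* [Milne1999LefschetzClasses] J. S. Milne, *Lefschetz classes on abelian varieties*, Duke Math. J. 96 (1999),
  p. 654, Prop. 3.6 (a), Cor. 4.5. [cite: Milne1999LefschetzClasses, §3 Prop. 3.6 (a) and p. 654]
* [Deligne1982HodgeCycles] P. Deligne, LNM 900 (1982), §4 (proof of Cor. 4.2). [cite: Deligne1982HodgeCycles, §4 proof of Cor. 4.2]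
* [Hazama1983] F. Hazama, Tôhoku Math. J. 35 (1983), §3 pp. 305–306. [cite: Hazama1983, §3 (pp. 305–306)]
* [Ribet1983] K. A. Ribet, Amer. J. Math. 105 (1983), Thm. 0. [cite: Ribet1983, Thm. 0]
* [Gordon1997] B. B. Gordon, arXiv:alg-geom/9709030, §3 and §7.7. [cite: Gordon1997, §3 and §7.7]
* [GoodmanWallachGTM255] R. Goodman, N. R. Wallach, GTM 255 (2009), §4.1.1, Thm. 5.3.3. [cite: GoodmanWallachGTM255, §4.1.1]
* [VoisinHodgeI2002] C. Voisin, *Hodge Theory I* (2002), §7.1.2, §11.3.1. [cite: VoisinHodgeI2002, §7.1.2]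
-/

noncomputable section

open scoped TensorProduct
open CategoryTheory Module NumberField

/-! ### §1 Hodge–Darboux bases of four-dimensional eigenblocks (abstract Hodge structures) -/

namespace Literature.AlgebraicGeometry.Motives

namespace HodgeStructure

section Darboux

universe u

variable {V : Type u} [AddCommGroup V] [Module ℚ V] [Module.Finite ℚ V] [HodgeTensorFacts.{u, u}] {n : ℤ}
variable {ι : Type*} [DecidableEq ι]

/-- **Hodge–Darboux bases of four-dimensional eigenblocks.** Let `H` be an effective polarized weight-one
`ℚ`-Hodge structure such that every Hodge endomorphism is `ψ`-self-adjoint, and `σ_i` characters of `End_Hdg`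
whose eigenblocks `T_i` form an internal direct sum and are four-dimensional. Then every `T_i` has a basis
`b_i : Fin 4 → T_i` with `b_i 0, b_i 1 ∈ V^{1,0}`, `b_i 2, b_i 3 ∈ V^{0,1}`, `ψ_ℂ(b_i 0, b_i 2) = ψ_ℂ(b_i 1, b_i 3) = 1`
and `ψ_ℂ(b_i 0, b_i 1) = ψ_ℂ(b_i 2, b_i 3) = ψ_ℂ(b_i 0, b_i 3) = ψ_ℂ(b_i 1, b_i 2) = 0`. Proof: `ψ_ℂ|_{T_i}` is
alternating (odd weight) and non-degenerate (`SymplecticBlocks.eq_zero_of_forall_block`), `J = Θ|_{T_i}`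
satisfies `J² = 1` and `ψ_ℂ(Jx, Jy) = -ψ_ℂ(x, y)` (`Θ ∈ Lie Hg ⊗ ℂ` is `ψ_ℂ`-skew), so Deligne's construction
(`Milne1999.exists_adapted_symplecticBasis`: the `±1`-eigenspaces `T_i ∩ V^{1,0}`, `T_i ∩ V^{0,1}` are transverse
Lagrangians in perfect duality) gives a symplectic basis of eigenvectors; `2m = 4`.
[cite: Deligne1982HodgeCycles, §4 proof of Cor. 4.2] [cite: Milne1999LefschetzClasses, §3 Prop. 3.6 (c) and p. 658] -/
theorem exists_hodgeDarboux_blockBasis_four (H : HodgeStructure V n) (hn : n = 1) (heff : H.IsEffective)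
    (ψ : H.Polarization)
    (hself : ∀ a : H.endAlg, LinearMap.IsAdjointPair ψ.form ψ.form (a : Module.End ℚ V) (a : Module.End ℚ V))
    (σ : ι → (H.endAlg →+* ℂ)) (hint : DirectSum.IsInternal fun i => H.eigenBlock (σ i))
    (h4 : ∀ i, Module.finrank ℂ (H.eigenBlock (σ i)) = 4) :
    ∃ b : ∀ i, Module.Basis (Fin 4) ℂ (H.eigenBlock (σ i)),
      (∀ i, (b i 0 : ℂ ⊗[ℚ] V) ∈ H.piece 1 0) ∧ (∀ i, (b i 1 : ℂ ⊗[ℚ] V) ∈ H.piece 1 0) ∧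
      (∀ i, (b i 2 : ℂ ⊗[ℚ] V) ∈ H.piece 0 1) ∧ (∀ i, (b i 3 : ℂ ⊗[ℚ] V) ∈ H.piece 0 1) ∧
      (∀ i, ψ.form.baseChange ℂ (b i 0 : ℂ ⊗[ℚ] V) (b i 2) = 1) ∧
      (∀ i, ψ.form.baseChange ℂ (b i 1 : ℂ ⊗[ℚ] V) (b i 3) = 1) ∧
      (∀ i, ψ.form.baseChange ℂ (b i 0 : ℂ ⊗[ℚ] V) (b i 1) = 0) ∧
      (∀ i, ψ.form.baseChange ℂ (b i 2 : ℂ ⊗[ℚ] V) (b i 3) = 0) ∧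
      (∀ i, ψ.form.baseChange ℂ (b i 0 : ℂ ⊗[ℚ] V) (b i 3) = 0) ∧
      (∀ i, ψ.form.baseChange ℂ (b i 1 : ℂ ⊗[ℚ] V) (b i 2) = 0) := by
  classical
  subst hn
  obtain ⟨Θ, hΘ⟩ := exists_hodgeTheta H
  obtain ⟨hP, hQ, -, -, hΘΘ⟩ := UnitaryTheta.theta_facts H rfl heff hΘ
  have hΘC : Θ ∈ H.hodgeLieC := H.mem_hodgeLieC_of_forall_piece hΘ
  have hodd : Odd (1 : ℤ) := ⟨0, by norm_num⟩
  -- eigenvectors of `Θ` lie in the Hodge pieces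
  have hplus : ∀ v : ℂ ⊗[ℚ] V, Θ v = v → v ∈ H.piece 1 0 := fun v hv => by
    have h := hP v
    rwa [hv, ← two_smul ℂ v, smul_smul, inv_mul_cancel₀ (two_ne_zero' ℂ), one_smul] at h
  have hminus : ∀ v : ℂ ⊗[ℚ] V, Θ v = -v → v ∈ H.piece 0 1 := fun v hv => by
    have h := hQ v
    rwa [hv, sub_neg_eq_add, ← two_smul ℂ v, smul_smul, inv_mul_cancel₀ (two_ne_zero' ℂ), one_smul] at h
  have key : ∀ i, ∃ b : Module.Basis (Fin 4) ℂ (H.eigenBlock (σ i)),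
      (b 0 : ℂ ⊗[ℚ] V) ∈ H.piece 1 0 ∧ (b 1 : ℂ ⊗[ℚ] V) ∈ H.piece 1 0 ∧
      (b 2 : ℂ ⊗[ℚ] V) ∈ H.piece 0 1 ∧ (b 3 : ℂ ⊗[ℚ] V) ∈ H.piece 0 1 ∧
      ψ.form.baseChange ℂ (b 0 : ℂ ⊗[ℚ] V) (b 2) = 1 ∧ ψ.form.baseChange ℂ (b 1 : ℂ ⊗[ℚ] V) (b 3) = 1 ∧
      ψ.form.baseChange ℂ (b 0 : ℂ ⊗[ℚ] V) (b 1) = 0 ∧ ψ.form.baseChange ℂ (b 2 : ℂ ⊗[ℚ] V) (b 3) = 0 ∧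
      ψ.form.baseChange ℂ (b 0 : ℂ ⊗[ℚ] V) (b 3) = 0 ∧ ψ.form.baseChange ℂ (b 1 : ℂ ⊗[ℚ] V) (b 2) = 0 := by
    intro i
    set T := H.eigenBlock (σ i) with hT
    haveI : FiniteDimensional ℂ T := Module.finite_of_finrank_eq_succ (h4 i)
    have hΘT : ∀ x ∈ T, Θ x ∈ T := fun x hx => H.apply_mem_eigenBlock_of_mem_hodgeLieC hΘC hx
    -- the restricted form and the restricted Hodge operator
    set B : LinearMap.BilinForm ℂ T := (ψ.form.baseChange ℂ).compl₁₂ T.subtype T.subtype with hB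
    have hBapply : ∀ x y : T, B x y = ψ.form.baseChange ℂ (x : ℂ ⊗[ℚ] V) (y : ℂ ⊗[ℚ] V) := fun x y => rfl
    set J : Module.End ℂ T := Θ.restrict hΘT with hJ
    have hJapply : ∀ x : T, ((J x : T) : ℂ ⊗[ℚ] V) = Θ x := fun x => rfl
    have hBalt : B.IsAlt := fun x => by
      change B x x = 0
      rw [hBapply]
      exact form_baseChange_self_eq_zero_of_odd H hodd ψ _
    have hleft : B.SeparatingLeft := fun x hx =>
      Subtype.ext (SymplecticBlocks.eq_zero_of_forall_block H ψ hself σ hint i x.2 fun y hy => by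
        have h := hx ⟨y, hy⟩
        rwa [hBapply] at h)
    have hBnd : B.Nondegenerate := by
      refine ⟨hleft, fun y hy => hleft y fun x => ?_⟩
      rw [hBapply, form_baseChange_swap_of_odd H hodd ψ, ← hBapply, hy x, neg_zero]
    have hJJ : ∀ x, J (J x) = ((1 : ℂ) ^ 2) • x := fun x => Subtype.ext (by
      rw [one_pow, one_smul, hJapply, hJapply, hΘΘ])
    have hJB : ∀ x y, B (J x) (J y) = -((1 : ℂ) ^ 2) * B x y := fun x y => by
      rw [hBapply, hBapply, hJapply, hJapply, formBaseChange_skew_of_mem_hodgeLieC ψ hΘC, hΘΘ]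
      ring
    obtain ⟨m, b₁, hll, hrr, hlr, hJl, hJr⟩ :=
      Literature.AlgebraicGeometry.Milne1999.exists_adapted_symplecticBasis B hBalt hBnd J one_ne_zero hJJ hJB
    -- `m = 2`
    have hm : m = 2 := by
      have h := Module.finrank_eq_card_basis b₁
      rw [h4 i, Fintype.card_sum, Fintype.card_fin] at h
      omega
    subst hm
    -- eigenvectors
    have hinl : ∀ j, ((b₁ (Sum.inl j) : T) : ℂ ⊗[ℚ] V) ∈ H.piece 1 0 := fun j => hplus _ (by
      rw [← hJapply, hJl, one_smul])
    have hinr : ∀ j, ((b₁ (Sum.inr j) : T) : ℂ ⊗[ℚ] V) ∈ H.piece 0 1 := fun j => hminus _ (by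
      rw [← hJapply, hJr, neg_one_smul, Submodule.coe_neg])
    -- reindex to `Fin 4`
    refine ⟨b₁.reindex finSumFinEquiv, ?_, ?_, ?_, ?_, ?_, ?_, ?_, ?_, ?_, ?_⟩
    all_goals simp only [Module.Basis.reindex_apply]
    · have e : finSumFinEquiv.symm (0 : Fin 4) = (Sum.inl 0 : Fin 2 ⊕ Fin 2) := by decide
      rw [e]; exact hinl 0
    · have e : finSumFinEquiv.symm (1 : Fin 4) = (Sum.inl 1 : Fin 2 ⊕ Fin 2) := by decide
      rw [e]; exact hinl 1
    · have e : finSumFinEquiv.symm (2 : Fin 4) = (Sum.inr 0 : Fin 2 ⊕ Fin 2) := by decide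
      rw [e]; exact hinr 0
    · have e : finSumFinEquiv.symm (3 : Fin 4) = (Sum.inr 1 : Fin 2 ⊕ Fin 2) := by decide
      rw [e]; exact hinr 1
    · have e0 : finSumFinEquiv.symm (0 : Fin 4) = (Sum.inl 0 : Fin 2 ⊕ Fin 2) := by decide
      have e2 : finSumFinEquiv.symm (2 : Fin 4) = (Sum.inr 0 : Fin 2 ⊕ Fin 2) := by decide
      rw [e0, e2, ← hBapply, hlr, if_pos rfl]
    · have e1 : finSumFinEquiv.symm (1 : Fin 4) = (Sum.inl 1 : Fin 2 ⊕ Fin 2) := by decide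
      have e3 : finSumFinEquiv.symm (3 : Fin 4) = (Sum.inr 1 : Fin 2 ⊕ Fin 2) := by decide
      rw [e1, e3, ← hBapply, hlr, if_pos rfl]
    · have e0 : finSumFinEquiv.symm (0 : Fin 4) = (Sum.inl 0 : Fin 2 ⊕ Fin 2) := by decide
      have e1 : finSumFinEquiv.symm (1 : Fin 4) = (Sum.inl 1 : Fin 2 ⊕ Fin 2) := by decide
      rw [e0, e1, ← hBapply, hll]
    · have e2 : finSumFinEquiv.symm (2 : Fin 4) = (Sum.inr 0 : Fin 2 ⊕ Fin 2) := by decide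
      have e3 : finSumFinEquiv.symm (3 : Fin 4) = (Sum.inr 1 : Fin 2 ⊕ Fin 2) := by decide
      rw [e2, e3, ← hBapply, hrr]
    · have e0 : finSumFinEquiv.symm (0 : Fin 4) = (Sum.inl 0 : Fin 2 ⊕ Fin 2) := by decide
      have e3 : finSumFinEquiv.symm (3 : Fin 4) = (Sum.inr 1 : Fin 2 ⊕ Fin 2) := by decide
      rw [e0, e3, ← hBapply, hlr, if_neg (by decide)]
    · have e1 : finSumFinEquiv.symm (1 : Fin 4) = (Sum.inl 1 : Fin 2 ⊕ Fin 2) := by decide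
      have e2 : finSumFinEquiv.symm (2 : Fin 4) = (Sum.inr 0 : Fin 2 ⊕ Fin 2) := by decide
      rw [e1, e2, ← hBapply, hlr, if_neg (by decide)]
  choose b h0 h1 h2 h3 h02 h13 h01 h23 h03 h12 using key
  exact ⟨b, h0, h1, h2, h3, h02, h13, h01, h23, h03, h12⟩

end Darboux

end HodgeStructure

end Literature.AlgebraicGeometry.Motives

namespace Literature.AlgebraicGeometry.HodgeTheory

open Literature.AlgebraicTopology.SingularHomology
open Literature.AlgebraicGeometry.Motives (IsSmoothProjective AbelianVariety bettiCohomology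
  ofRatClassBaseChange ofRatClassBaseChange_tmul HodgeTensorFacts)
open Literature.AlgebraicGeometry.Motives.HodgeStructure
open Literature.AlgebraicGeometry.ComplexMultiplication
open Literature.Barriers.HodgeConjecture
open Literature.RepresentationTheory.GeneralLinear
open Literature.NumberTheory.DiophantineGeometry

/-! ### §2 The `ψ`-Casimir classes on four-dimensional blocks -/

section RM

variable {A B : AbelianVariety ℂ} {n : ℕ}

variable (hF : IsField A.endAlgebra)

/-- **The characters `hodgeCharacter τ` are pairwise distinct** (`τ ↦ τ ∘ (End_Hdg ≅ F)`).
[cite: Deligne1982HodgeCycles, §4 p. 30] -/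
theorem hodgeCharacter_injective (hHD : exists_isReal_hodgeModel) (hI : hodgePQ_independent_of_hodgeModel) :
    Function.Injective (hodgeCharacter hF hHD hI) := by
  intro τ τ' h
  refine RingHom.ext fun e => ?_
  have h1 := RingHom.congr_fun h (endFieldAlgEquivEndAlg hF hHD hI e)
  rwa [hodgeCharacter_apply, hodgeCharacter_apply] at h1

/-- **The Casimir class computed in a block family and its blockwise dual family** (any block size): for
block bases `b_τ` of `H ⊗ ℂ = ⊕_τ V_τ` and vectors `d(τ, a) ∈ V_τ` with `ψ_ℂ(d(τ,a), b_τ c) = δ_{ac}`,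
`Λ(Y) = ∑_τ ∑_a ρ(Y d(τ,a)) ⌣ ρ(b_τ a)` (independence of the Casimir contraction from the pair of dual bases,
`sum_dual_eq_sum_dual`; the blocks are `ψ_ℂ`-orthogonal because `F` is totally real, hence self-adjoint).
[cite: Hazama1983, §3 (p. 305)] [cite: GoodmanWallachGTM255, §4.1.1] -/
theorem casimirClass_eq_sum_dualFamily (hHD : exists_isReal_hodgeModel)
    (hI : hodgePQ_independent_of_hodgeModel) [IsTotallyReal (EndField A hF)] (hA0 : 0 < A.dim)
    (ψ : (BettiUniverse.hodge hHD (AbelianVariety.isSmoothProjective_holds (A := A)) 1).Polarization)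
    {m : ℕ} (b : ∀ τ : EndField A hF →+* ℂ, Module.Basis (Fin m) ℂ
      ((BettiUniverse.hodge hHD (AbelianVariety.isSmoothProjective_holds (A := A)) 1).eigenBlock
        (hodgeCharacter hF hHD hI τ)))
    (d : (EndField A hF →+* ℂ) × Fin m → ℂ ⊗[ℚ] bettiCohomology A.X 1)
    (hdT : ∀ τ a, d (τ, a) ∈
      (BettiUniverse.hodge hHD (AbelianVariety.isSmoothProjective_holds (A := A)) 1).eigenBlock
        (hodgeCharacter hF hHD hI τ))
    (hdual : ∀ τ a c, ψ.form.baseChange ℂ (d (τ, a)) (b τ c : ℂ ⊗[ℚ] bettiCohomology A.X 1) =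
      if a = c then 1 else 0)
    {ι : Type*} [Fintype ι] [DecidableEq ι] (e : Module.Basis ι ℚ (bettiCohomology A.X 1))
    (Y : Module.End ℂ (ℂ ⊗[ℚ] bettiCohomology A.X 1)) :
    casimirClass A ψ.form ψ.nondegenerate e Y =
      ∑ τ, ∑ a, cupH1 A (Y (d (τ, a))) (b τ a : ℂ ⊗[ℚ] bettiCohomology A.X 1) := by
  classical
  haveI : Module.Finite ℚ (bettiCohomology A.X 1) := finite_bettiCohomology_one A
  have hX : IsSmoothProjective A.dim A.X := AbelianVariety.isSmoothProjective_holds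
  have hint := isInternal_eigenBlock_hodgeCharacter hF hHD hI
  have hself := isAdjointPair_self_of_isTotallyReal hF hHD hI hA0 ψ
  have hσinj := hodgeCharacter_injective hF hHD hI
  set Ψ := ψ.form.baseChange ℂ with hΨ
  set w' : (EndField A hF →+* ℂ) × Fin m → ℂ ⊗[ℚ] bettiCohomology A.X 1 := fun τr => b τr.1 τr.2
    with hw'
  have hdual' : ∀ j k, Ψ (d j) (w' k) = if k = j then 1 else 0 := by
    rintro ⟨τ, a⟩ ⟨τ', c⟩
    change Ψ (d (τ, a)) (b τ' c : ℂ ⊗[ℚ] bettiCohomology A.X 1) = _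
    by_cases hττ' : τ = τ'
    · subst hττ'
      rw [hΨ, hdual]
      by_cases hac : a = c
      · subst hac; rw [if_pos rfl, if_pos rfl]
      · rw [if_neg hac, if_neg (fun h => hac (congrArg Prod.snd h).symm)]
    · rw [if_neg (fun h => hττ' (congrArg Prod.fst h).symm)]
      exact form_eq_zero_of_mem_eigenBlock_of_isAdjointPair (BettiUniverse.hodge hHD hX 1) ψ hself
        (fun h => hττ' (hσinj h)) (hdT τ a) (b τ' c).2
  -- separation: a vector orthogonal to all `d(τ, a)` has all block coordinates zero
  have hsep : ∀ y, (∀ j, Ψ (d j) y = 0) → y = 0 := by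
    intro y hy
    set cb := hint.collectedBasis b with hcb
    have hcb_apply : ∀ τ c, cb ⟨τ, c⟩ = (b τ c : ℂ ⊗[ℚ] bettiCohomology A.X 1) := fun τ c => by
      rw [hcb, DirectSum.IsInternal.collectedBasis_coe]
    have hcoord : ∀ τ a, cb.repr y ⟨τ, a⟩ = 0 := by
      intro τ a
      have h := hy (τ, a)
      rw [← cb.sum_repr y, map_sum, Finset.sum_eq_single (⟨τ, a⟩ : Σ _ : EndField A hF →+* ℂ, Fin m)] at h
      · rwa [map_smul, smul_eq_mul, hcb_apply, hdual, if_pos rfl, mul_one] at h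
      · rintro ⟨τ', c⟩ _ hne
        rw [map_smul, smul_eq_mul, hcb_apply,
          show (b τ' c : ℂ ⊗[ℚ] bettiCohomology A.X 1) = w' (τ', c) from rfl, hdual',
          if_neg (fun h => hne (by cases h; rfl)), mul_zero]
      · intro h; exact absurd (Finset.mem_univ _) h
    rw [← cb.sum_repr y]
    refine Finset.sum_eq_zero fun j _ => ?_
    obtain ⟨τ, a⟩ := j
    rw [hcoord, zero_smul]
  rw [casimirClass_apply, sum_dual_eq_sum_dual Ψ (cupH1 A) _ _
    (eq_sum_formBaseChange_smul_dualBasis ψ.form ψ.nondegenerate e) w' d hdual' hsep Y,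
    Fintype.sum_prod_type]

/-- **The Casimir class in Hodge–Darboux block coordinates** (four-dimensional blocks with Gram matrix
`( 0 I ; -I 0 )`): `Λ(Y) = ∑_τ [ρ(Y b_τ0) ⌣ ρ(b_τ2) − ρ(Y b_τ2) ⌣ ρ(b_τ0) + ρ(Y b_τ1) ⌣ ρ(b_τ3) − ρ(Y b_τ3) ⌣ ρ(b_τ1)]`
(the blockwise dual family is `(-b_τ2, -b_τ3, b_τ0, b_τ1)`). [cite: Hazama1983, §3 (p. 305)]
[cite: GoodmanWallachGTM255, §4.1.1] [cite: Milne1999LefschetzClasses, p. 654] -/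
theorem casimirClass_eq_sum_blocks_darboux (hHD : exists_isReal_hodgeModel)
    (hI : hodgePQ_independent_of_hodgeModel) [IsTotallyReal (EndField A hF)] (hA0 : 0 < A.dim)
    (ψ : (BettiUniverse.hodge hHD (AbelianVariety.isSmoothProjective_holds (A := A)) 1).Polarization)
    (b : ∀ τ : EndField A hF →+* ℂ, Module.Basis (Fin 4) ℂ
      ((BettiUniverse.hodge hHD (AbelianVariety.isSmoothProjective_holds (A := A)) 1).eigenBlock
        (hodgeCharacter hF hHD hI τ)))
    (h02 : ∀ τ, ψ.form.baseChange ℂ (b τ 0 : ℂ ⊗[ℚ] bettiCohomology A.X 1) (b τ 2) = 1)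
    (h13 : ∀ τ, ψ.form.baseChange ℂ (b τ 1 : ℂ ⊗[ℚ] bettiCohomology A.X 1) (b τ 3) = 1)
    (h01 : ∀ τ, ψ.form.baseChange ℂ (b τ 0 : ℂ ⊗[ℚ] bettiCohomology A.X 1) (b τ 1) = 0)
    (h23 : ∀ τ, ψ.form.baseChange ℂ (b τ 2 : ℂ ⊗[ℚ] bettiCohomology A.X 1) (b τ 3) = 0)
    (h03 : ∀ τ, ψ.form.baseChange ℂ (b τ 0 : ℂ ⊗[ℚ] bettiCohomology A.X 1) (b τ 3) = 0)
    (h12 : ∀ τ, ψ.form.baseChange ℂ (b τ 1 : ℂ ⊗[ℚ] bettiCohomology A.X 1) (b τ 2) = 0)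
    {ι : Type*} [Fintype ι] [DecidableEq ι] (e : Module.Basis ι ℚ (bettiCohomology A.X 1))
    (Y : Module.End ℂ (ℂ ⊗[ℚ] bettiCohomology A.X 1)) :
    casimirClass A ψ.form ψ.nondegenerate e Y =
      ∑ τ, (cupH1 A (Y (b τ 0)) (b τ 2) - cupH1 A (Y (b τ 2)) (b τ 0) +
        (cupH1 A (Y (b τ 1)) (b τ 3) - cupH1 A (Y (b τ 3)) (b τ 1))) := by
  classical
  have hX : IsSmoothProjective A.dim A.X := AbelianVariety.isSmoothProjective_holds
  have hodd : Odd (((1 : ℕ) : ℤ)) := ⟨0, by norm_num⟩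
  set Ψ := ψ.form.baseChange ℂ with hΨ
  have hself0 : ∀ τ (a : Fin 4), Ψ (b τ a : ℂ ⊗[ℚ] bettiCohomology A.X 1) (b τ a) = 0 := fun τ a =>
    form_baseChange_self_eq_zero_of_odd (BettiUniverse.hodge hHD hX 1) hodd ψ _
  have hswap : ∀ τ (a c : Fin 4), Ψ (b τ c : ℂ ⊗[ℚ] bettiCohomology A.X 1) (b τ a) =
      -Ψ (b τ a : ℂ ⊗[ℚ] bettiCohomology A.X 1) (b τ c) := fun τ a c =>
    form_baseChange_swap_of_odd (BettiUniverse.hodge hHD hX 1) hodd ψ _ _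
  -- the blockwise dual family
  set d : (EndField A hF →+* ℂ) × Fin 4 → ℂ ⊗[ℚ] bettiCohomology A.X 1 := fun τa =>
    ![-(b τa.1 2 : ℂ ⊗[ℚ] bettiCohomology A.X 1), -(b τa.1 3 : ℂ ⊗[ℚ] bettiCohomology A.X 1),
      (b τa.1 0 : ℂ ⊗[ℚ] bettiCohomology A.X 1), (b τa.1 1 : ℂ ⊗[ℚ] bettiCohomology A.X 1)] τa.2 with hd
  have hd0 : ∀ τ, d (τ, 0) = -(b τ 2 : ℂ ⊗[ℚ] bettiCohomology A.X 1) := fun τ => rfl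
  have hd1 : ∀ τ, d (τ, 1) = -(b τ 3 : ℂ ⊗[ℚ] bettiCohomology A.X 1) := fun τ => rfl
  have hd2 : ∀ τ, d (τ, 2) = (b τ 0 : ℂ ⊗[ℚ] bettiCohomology A.X 1) := fun τ => rfl
  have hd3 : ∀ τ, d (τ, 3) = (b τ 1 : ℂ ⊗[ℚ] bettiCohomology A.X 1) := fun τ => rfl
  have hdT : ∀ τ a, d (τ, a) ∈ (BettiUniverse.hodge hHD hX 1).eigenBlock (hodgeCharacter hF hHD hI τ) := by
    intro τ a
    fin_cases a
    · exact Submodule.neg_mem _ (b τ 2).2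
    · exact Submodule.neg_mem _ (b τ 3).2
    · exact (b τ 0).2
    · exact (b τ 1).2
  -- the sixteen pairings
  have h20 : ∀ τ, Ψ (b τ 2 : ℂ ⊗[ℚ] bettiCohomology A.X 1) (b τ 0) = -1 := fun τ => by rw [hswap, h02]
  have h31 : ∀ τ, Ψ (b τ 3 : ℂ ⊗[ℚ] bettiCohomology A.X 1) (b τ 1) = -1 := fun τ => by rw [hswap, h13]
  have h10 : ∀ τ, Ψ (b τ 1 : ℂ ⊗[ℚ] bettiCohomology A.X 1) (b τ 0) = 0 := fun τ => by
    rw [hswap, h01, neg_zero]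
  have h32 : ∀ τ, Ψ (b τ 3 : ℂ ⊗[ℚ] bettiCohomology A.X 1) (b τ 2) = 0 := fun τ => by
    rw [hswap, h23, neg_zero]
  have h30 : ∀ τ, Ψ (b τ 3 : ℂ ⊗[ℚ] bettiCohomology A.X 1) (b τ 0) = 0 := fun τ => by
    rw [hswap, h03, neg_zero]
  have h21 : ∀ τ, Ψ (b τ 2 : ℂ ⊗[ℚ] bettiCohomology A.X 1) (b τ 1) = 0 := fun τ => by
    rw [hswap, h12, neg_zero]
  have hdual : ∀ τ (a c : Fin 4), Ψ (d (τ, a)) (b τ c : ℂ ⊗[ℚ] bettiCohomology A.X 1) =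
      if a = c then 1 else 0 := by
    intro τ a c
    fin_cases a <;> fin_cases c <;>
      simp only [Fin.zero_eta, Fin.isValue, Fin.mk_one, Fin.reduceFinMk, hd0, hd1, hd2, hd3, map_neg,
        LinearMap.neg_apply, hself0, h20, h31, h10, h32, h30, h21, h02, h13, h01, h23, h03, h12, neg_neg,
        neg_zero] <;>
      simp
  rw [casimirClass_eq_sum_dualFamily hF hHD hI hA0 ψ b d hdT hdual e Y]
  refine Finset.sum_congr rfl fun τ _ => ?_
  rw [Fin.sum_univ_four, hd0, hd1, hd2, hd3]
  simp only [map_neg, LinearMap.neg_apply]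
  abel

/-- **An operator acting on every block `V_τ` by a scalar lies in `End_Hdg(H¹) ⊗ ℂ`** (it commutes with
`Lie Hdg ⊗ ℂ ∋ Θ`, whose elements preserve the blocks; `ThetaSubalgebra.mem_span_endAlg_of_forall_commute`).
Hazama 1983 §3: the projections `p_i` onto the `V_i` come from `End⁰(A) ⊗ ℂ`. [cite: Hazama1983, §3 (p. 305)] -/
theorem blockScalar_mem_span_endAlg [HodgeTensorFacts.{0, 0}] [Module.Finite ℚ (bettiCohomology A.X 1)]
    (hHD : exists_isReal_hodgeModel) (hI : hodgePQ_independent_of_hodgeModel) {m : ℕ}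
    (b : ∀ τ : EndField A hF →+* ℂ, Module.Basis (Fin m) ℂ
      ((BettiUniverse.hodge hHD (AbelianVariety.isSmoothProjective_holds (A := A)) 1).eigenBlock
        (hodgeCharacter hF hHD hI τ)))
    (c : (EndField A hF →+* ℂ) → ℂ) {P : Module.End ℂ (ℂ ⊗[ℚ] bettiCohomology A.X 1)}
    (hPb : ∀ τ (x : ℂ ⊗[ℚ] bettiCohomology A.X 1),
      x ∈ (BettiUniverse.hodge hHD (AbelianVariety.isSmoothProjective_holds (A := A)) 1).eigenBlock
        (hodgeCharacter hF hHD hI τ) → P x = c τ • x) :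
    P ∈ Submodule.span ℂ ((fun a : Module.End ℚ (bettiCohomology A.X 1) => a.baseChange ℂ) ''
      ((BettiUniverse.hodge hHD (AbelianVariety.isSmoothProjective_holds (A := A)) 1).endAlg :
        Set (Module.End ℚ (bettiCohomology A.X 1)))) := by
  classical
  have hX : IsSmoothProjective A.dim A.X := AbelianVariety.isSmoothProjective_holds
  have hint := isInternal_eigenBlock_hodgeCharacter hF hHD hI
  have _hb := b
  obtain ⟨Θ, hΘ⟩ := exists_hodgeTheta (BettiUniverse.hodge hHD hX 1)
  have hΘC : Θ ∈ spanC (BettiUniverse.hodge hHD hX 1).hodgeLie := by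
    rw [← hodgeLieC_eq_spanC]; exact (BettiUniverse.hodge hHD hX 1).mem_hodgeLieC_of_forall_piece hΘ
  refine ThetaSubalgebra.mem_span_endAlg_of_forall_commute (BettiUniverse.hodge hHD hX 1)
    (BettiUniverse.hodge hHD hX 1).hodgeLie hΘ hΘC fun X hXm => ?_
  have hXT : ∀ τ', Set.MapsTo (X.baseChange ℂ)
      ((BettiUniverse.hodge hHD hX 1).eigenBlock (hodgeCharacter hF hHD hI τ'))
      ((BettiUniverse.hodge hHD hX 1).eigenBlock (hodgeCharacter hF hHD hI τ')) :=
    mapsTo_of_mem_hodgeLieC (BettiUniverse.hodge hHD hX 1) (hodgeCharacter hF hHD hI) (baseChange_mem_spanC hXm)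
  refine LinearMap.ext fun x => ?_
  have hx : x ∈ ⨆ τ', (BettiUniverse.hodge hHD hX 1).eigenBlock (hodgeCharacter hF hHD hI τ') := by
    rw [hint.submodule_iSup_eq_top]; exact Submodule.mem_top
  induction hx using Submodule.iSup_induction' with
  | mem τ' x hx =>
    rw [Module.End.mul_apply, Module.End.mul_apply, hPb τ' x hx, hPb τ' _ (hXT τ' hx), map_smul]
  | zero => simp
  | add x x' _ _ hx hx' => rw [map_add, map_add, hx, hx']

open scoped Classical in
/-- **The block projectors exist**: for every place `τ` an operator `P_τ` of `H¹ ⊗ ℂ` acting by `[τ' = τ]` on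
`V_{τ'}` (defined on the collected block basis). [cite: Hazama1983, §3 (p. 305)] -/
theorem exists_blockProjector (hHD : exists_isReal_hodgeModel) (hI : hodgePQ_independent_of_hodgeModel)
    {m : ℕ} (b : ∀ τ : EndField A hF →+* ℂ, Module.Basis (Fin m) ℂ
      ((BettiUniverse.hodge hHD (AbelianVariety.isSmoothProjective_holds (A := A)) 1).eigenBlock
        (hodgeCharacter hF hHD hI τ)))
    (τ : EndField A hF →+* ℂ) :
    ∃ P : Module.End ℂ (ℂ ⊗[ℚ] bettiCohomology A.X 1), ∀ τ' (x : ℂ ⊗[ℚ] bettiCohomology A.X 1),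
      x ∈ (BettiUniverse.hodge hHD (AbelianVariety.isSmoothProjective_holds (A := A)) 1).eigenBlock
        (hodgeCharacter hF hHD hI τ') → P x = (if τ' = τ then (1 : ℂ) else 0) • x := by
  classical
  haveI : Module.Finite ℚ (bettiCohomology A.X 1) := finite_bettiCohomology_one A
  have hint := isInternal_eigenBlock_hodgeCharacter hF hHD hI
  set cb := hint.collectedBasis b with hcb
  have hcb_apply : ∀ τ' c, cb ⟨τ', c⟩ = (b τ' c : ℂ ⊗[ℚ] bettiCohomology A.X 1) := fun τ' c => by
    rw [hcb, DirectSum.IsInternal.collectedBasis_coe]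
  set P : Module.End ℂ (ℂ ⊗[ℚ] bettiCohomology A.X 1) := cb.constr ℂ fun j : Σ _ : EndField A hF →+* ℂ, Fin m =>
    if j.1 = τ then (b j.1 j.2 : ℂ ⊗[ℚ] bettiCohomology A.X 1) else 0 with hP
  have hPbasis : ∀ τ' c, P (b τ' c : ℂ ⊗[ℚ] bettiCohomology A.X 1) =
      (if τ' = τ then (1 : ℂ) else 0) • (b τ' c : ℂ ⊗[ℚ] bettiCohomology A.X 1) := by
    intro τ' c
    rw [← hcb_apply, hP, Module.Basis.constr_basis]
    by_cases h : τ' = τ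
    · rw [if_pos h, if_pos h, one_smul, hcb_apply]
    · rw [if_neg h, if_neg h, zero_smul]
  refine ⟨P, fun τ' x hx => ?_⟩
  have hx' : x = ∑ c, (b τ').repr ⟨x, hx⟩ c • (b τ' c : ℂ ⊗[ℚ] bettiCohomology A.X 1) := by
    conv_lhs => rw [show x = ((⟨x, hx⟩ : (BettiUniverse.hodge hHD
      (AbelianVariety.isSmoothProjective_holds (A := A)) 1).eigenBlock (hodgeCharacter hF hHD hI τ')) : _)
      from rfl, ← (b τ').sum_repr ⟨x, hx⟩]
    simp only [Submodule.coe_sum, Submodule.coe_smul]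
  rw [hx', map_sum, Finset.smul_sum]
  refine Finset.sum_congr rfl fun c _ => ?_
  rw [map_smul, hPbasis, smul_comm]

/-- **Theorem (`ρ(b_τ 0) ⌣ ρ(b_τ 2) + ρ(b_τ 1) ⌣ ρ(b_τ 3) ∈ B¹(A) ⊗ ℂ`; Murty 1984 §3 / Milne 1999 Prop. 3.6 (a),
p. 654: the symplectic form `ω_τ ∈ Λ² V_τ` of each factor is a divisor class).** For `A` with `End⁰(A)` a
totally real field, a polarization `ψ` of `H¹(A(ℂ); ℚ)` and Hodge–Darboux block bases `b_τ` of the eigenblocks,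
the class `θ_τ = ρ(b_τ 0) ⌣ ρ(b_τ 2) + ρ(b_τ 1) ⌣ ρ(b_τ 3) ∈ H²(A(ℂ); ℂ)` is a `ℂ`-combination of RATIONAL
`(1,1)`-classes: `2 θ_τ = Λ(p_τ) ∈ span_ℂ {Λ(a ⊗ 1) : a ∈ End_Hdg}` (`p_τ` the block projector,
`blockScalar_mem_span_endAlg`), each `Λ(a ⊗ 1)` is rational (`isRationalClass_casimirClass_baseChange`) and of
type `(1,1)` (`casimirClass_eq_sum_blocks_darboux`: `a` is the scalar `τ(a)` on `V_τ`, the kinds of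
`(b_τ0, b_τ2)`, `(b_τ1, b_τ3)` are `(1,0), (0,1)`). [cite: Murty1984, §3] [cite: Milne1999LefschetzClasses, §3 Prop. 3.6 (a) and p. 654]
[cite: Ribet1983, Thm. 0] [cite: Hazama1983, §3 (pp. 305–306)] -/
theorem thetaFour_mem_span_rational_oneOne [HodgeTensorFacts.{0, 0}] (hHD : exists_isReal_hodgeModel)
    (hI : hodgePQ_independent_of_hodgeModel) [IsTotallyReal (EndField A hF)] (hA0 : 0 < A.dim)
    (ψ : (BettiUniverse.hodge hHD (AbelianVariety.isSmoothProjective_holds (A := A)) 1).Polarization)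
    (b : ∀ τ : EndField A hF →+* ℂ, Module.Basis (Fin 4) ℂ
      ((BettiUniverse.hodge hHD (AbelianVariety.isSmoothProjective_holds (A := A)) 1).eigenBlock
        (hodgeCharacter hF hHD hI τ)))
    (hb0 : ∀ τ, (b τ 0 : ℂ ⊗[ℚ] bettiCohomology A.X 1) ∈
      (BettiUniverse.hodge hHD (AbelianVariety.isSmoothProjective_holds (A := A)) 1).piece 1 0)
    (hb1 : ∀ τ, (b τ 1 : ℂ ⊗[ℚ] bettiCohomology A.X 1) ∈
      (BettiUniverse.hodge hHD (AbelianVariety.isSmoothProjective_holds (A := A)) 1).piece 1 0)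
    (hb2 : ∀ τ, (b τ 2 : ℂ ⊗[ℚ] bettiCohomology A.X 1) ∈
      (BettiUniverse.hodge hHD (AbelianVariety.isSmoothProjective_holds (A := A)) 1).piece 0 1)
    (hb3 : ∀ τ, (b τ 3 : ℂ ⊗[ℚ] bettiCohomology A.X 1) ∈
      (BettiUniverse.hodge hHD (AbelianVariety.isSmoothProjective_holds (A := A)) 1).piece 0 1)
    (h02 : ∀ τ, ψ.form.baseChange ℂ (b τ 0 : ℂ ⊗[ℚ] bettiCohomology A.X 1) (b τ 2) = 1)
    (h13 : ∀ τ, ψ.form.baseChange ℂ (b τ 1 : ℂ ⊗[ℚ] bettiCohomology A.X 1) (b τ 3) = 1)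
    (h01 : ∀ τ, ψ.form.baseChange ℂ (b τ 0 : ℂ ⊗[ℚ] bettiCohomology A.X 1) (b τ 1) = 0)
    (h23 : ∀ τ, ψ.form.baseChange ℂ (b τ 2 : ℂ ⊗[ℚ] bettiCohomology A.X 1) (b τ 3) = 0)
    (h03 : ∀ τ, ψ.form.baseChange ℂ (b τ 0 : ℂ ⊗[ℚ] bettiCohomology A.X 1) (b τ 3) = 0)
    (h12 : ∀ τ, ψ.form.baseChange ℂ (b τ 1 : ℂ ⊗[ℚ] bettiCohomology A.X 1) (b τ 2) = 0)
    (τ : EndField A hF →+* ℂ) :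
    cupH1 A (b τ 0 : ℂ ⊗[ℚ] bettiCohomology A.X 1) (b τ 2) + cupH1 A (b τ 1 : ℂ ⊗[ℚ] bettiCohomology A.X 1) (b τ 3) ∈
      Submodule.span ℂ {c : complexBetti A.X 2 | IsRationalClass c ∧ IsOfHodgeType A.dim A.X 2 1 1 c} := by
  classical
  have hX : IsSmoothProjective A.dim A.X := AbelianVariety.isSmoothProjective_holds
  haveI : Module.Finite ℚ (bettiCohomology A.X 1) := finite_bettiCohomology_one A
  set e := Module.finBasis ℚ (bettiCohomology A.X 1) with he
  set Λ := casimirClass A ψ.form ψ.nondegenerate e with hΛ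
  set S := Submodule.span ℂ
    {c : complexBetti A.X 2 | IsRationalClass c ∧ IsOfHodgeType A.dim A.X 2 1 1 c} with hS
  -- Hodge types of the block letters and of their cup products
  have ht10 : ∀ (x : ℂ ⊗[ℚ] bettiCohomology A.X 1), x ∈ (BettiUniverse.hodge hHD hX 1).piece 1 0 →
      IsOfHodgeType A.dim A.X 1 1 0 (ofRatClassBaseChange (Motives.ComplexPoints A.X) 1 x) :=
    fun x hx => (BettiUniverse.mem_hodge_piece_iff hHD hI hX (k := 1) (p := 1) (q := 0) rfl _).1 hx
  have ht01 : ∀ (x : ℂ ⊗[ℚ] bettiCohomology A.X 1), x ∈ (BettiUniverse.hodge hHD hX 1).piece 0 1 →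
      IsOfHodgeType A.dim A.X 1 0 1 (ofRatClassBaseChange (Motives.ComplexPoints A.X) 1 x) :=
    fun x hx => (BettiUniverse.mem_hodge_piece_iff hHD hI hX (k := 1) (p := 0) (q := 1) rfl _).1 hx
  have hcup := BettiUniverse.cupPreservesHodgeType hHD hI hX
  have hPQ : ∀ (x y : ℂ ⊗[ℚ] bettiCohomology A.X 1), x ∈ (BettiUniverse.hodge hHD hX 1).piece 1 0 →
      y ∈ (BettiUniverse.hodge hHD hX 1).piece 0 1 → IsOfHodgeType A.dim A.X 2 1 1 (cupH1 A x y) := by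
    intro x y hx hy
    have h : IsOfHodgeType A.dim A.X 2 (1 + 0) (0 + 1) _ := hcup (rfl : 1 + 1 = 2) (ht10 x hx) (ht01 y hy)
    rw [cupH1_apply]
    exact h
  have hQP : ∀ (x y : ℂ ⊗[ℚ] bettiCohomology A.X 1), x ∈ (BettiUniverse.hodge hHD hX 1).piece 0 1 →
      y ∈ (BettiUniverse.hodge hHD hX 1).piece 1 0 → IsOfHodgeType A.dim A.X 2 1 1 (cupH1 A x y) := by
    intro x y hx hy
    have h : IsOfHodgeType A.dim A.X 2 (0 + 1) (1 + 0) _ := hcup (rfl : 1 + 1 = 2) (ht01 x hx) (ht10 y hy)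
    rw [cupH1_apply]
    exact h
  -- (1) `Λ(a ⊗ 1) ∈ S` for `a ∈ End_Hdg`
  have hΛa : ∀ a : (BettiUniverse.hodge hHD hX 1).endAlg,
      Λ ((a : Module.End ℚ (bettiCohomology A.X 1)).baseChange ℂ) ∈ S := by
    intro a
    refine Submodule.subset_span ⟨isRationalClass_casimirClass_baseChange ψ.form ψ.nondegenerate e _, ?_⟩
    rw [hΛ, casimirClass_eq_sum_blocks_darboux hF hHD hI hA0 ψ b h02 h13 h01 h23 h03 h12 e]
    obtain ⟨M⟩ := nonempty_hodgeModel_holds hX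
    refine IsOfHodgeType.sum hX M _ _ fun τ' _ => ?_
    have ha : ∀ r, (a : Module.End ℚ (bettiCohomology A.X 1)).baseChange ℂ
        (b τ' r : ℂ ⊗[ℚ] bettiCohomology A.X 1) = hodgeCharacter hF hHD hI τ' a • (b τ' r : _) :=
      fun r => ((BettiUniverse.hodge hHD hX 1).mem_eigenBlock_iff _ _).1 (b τ' r).2 a
    rw [ha, ha, ha, ha, map_smul, LinearMap.smul_apply, map_smul, LinearMap.smul_apply, map_smul,
      LinearMap.smul_apply, map_smul, LinearMap.smul_apply]
    exact IsOfHodgeType.add hX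
      (IsOfHodgeType.sub hX ((hPQ _ _ (hb0 τ') (hb2 τ')).smul _) ((hQP _ _ (hb2 τ') (hb0 τ')).smul _))
      (IsOfHodgeType.sub hX ((hPQ _ _ (hb1 τ') (hb3 τ')).smul _) ((hQP _ _ (hb3 τ') (hb1 τ')).smul _))
  -- (2) the block projector `P_τ ∈ End_Hdg ⊗ ℂ`, so `Λ(P_τ) ∈ S`
  obtain ⟨P, hPb⟩ := exists_blockProjector hF hHD hI b τ
  have hΛP : Λ P ∈ S := by
    have hPmem := blockScalar_mem_span_endAlg hF hHD hI b (fun τ' => if τ' = τ then (1 : ℂ) else 0) hPb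
    have hle : Submodule.span ℂ ((fun a : Module.End ℚ (bettiCohomology A.X 1) => a.baseChange ℂ) ''
        ((BettiUniverse.hodge hHD hX 1).endAlg : Set (Module.End ℚ (bettiCohomology A.X 1)))) ≤ S.comap Λ := by
      refine Submodule.span_le.2 ?_
      rintro _ ⟨a, ha, rfl⟩
      exact hΛa ⟨a, ha⟩
    exact hle hPmem
  -- (3) `Λ(P_τ) = 2 θ_τ`
  have hPb' : ∀ τ' (r : Fin 4), P (b τ' r : ℂ ⊗[ℚ] bettiCohomology A.X 1) =
      (if τ' = τ then (1 : ℂ) else 0) • (b τ' r : _) := fun τ' r => hPb τ' _ (b τ' r).2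
  have hgc : ∀ x y : ℂ ⊗[ℚ] bettiCohomology A.X 1, cupH1 A y x = -cupH1 A x y := fun x y => by
    rw [cupH1_apply, cupH1_apply, cupProduct_gradedComm_holds ℂ (Motives.ComplexPoints A.X)
      (rfl : 1 + 1 = 2) (rfl : 1 + 1 = 2)]
    norm_num
  have hΛPeq : Λ P = (2 : ℂ) • (cupH1 A (b τ 0 : ℂ ⊗[ℚ] bettiCohomology A.X 1) (b τ 2) +
      cupH1 A (b τ 1 : ℂ ⊗[ℚ] bettiCohomology A.X 1) (b τ 3)) := by
    rw [hΛ, casimirClass_eq_sum_blocks_darboux hF hHD hI hA0 ψ b h02 h13 h01 h23 h03 h12 e, Finset.sum_eq_single τ]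
    · rw [hPb', hPb', hPb', hPb', if_pos rfl, one_smul, one_smul, one_smul, one_smul,
        hgc (b τ 0 : ℂ ⊗[ℚ] bettiCohomology A.X 1) (b τ 2), hgc (b τ 1 : ℂ ⊗[ℚ] bettiCohomology A.X 1) (b τ 3),
        sub_neg_eq_add, sub_neg_eq_add, two_smul]
      abel
    · intro τ' _ hτ'
      rw [hPb', hPb', hPb', hPb', if_neg hτ', zero_smul, zero_smul, zero_smul, zero_smul, LinearMap.map_zero₂,
        LinearMap.map_zero₂, LinearMap.map_zero₂, LinearMap.map_zero₂]
      simp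
    · intro h; exact absurd (Finset.mem_univ τ) h
  have h := S.smul_mem (2 : ℂ)⁻¹ hΛP
  rwa [hΛPeq, smul_smul, inv_mul_cancel₀ (two_ne_zero' ℂ), one_smul] at h

/-! ### §3 Crossed classes of two slots at the same place; the hypothesis `hcross` of the several-blocks criterion -/

/-- **The crossed class of two slots AT THE SAME PLACE lies in `D¹(B) ⊗ ℂ`** (four-dimensional blocks): with
`x r = g_j^* ρ(b_τ r)`, `y r = g_{j'}^* ρ(b_τ r)`,
`x0 ⌣ y2 + y0 ⌣ x2 + x1 ⌣ y3 + y1 ⌣ x3 = (g_j + g_{j'})^* θ_τ − g_j^* θ_τ − g_{j'}^* θ_τ`, `θ_τ ∈ B¹(A) ⊗ ℂ`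
(`thetaFour_mem_span_rational_oneOne`); pull-backs are additive on `H¹`, multiplicative, and preserve rational
`(1,1)`-classes (the tree's per-place lemma `rmLetters_cross_mem_span_rational_oneOne`, now for `Sp₄` blocks).
[cite: Gordon1997, §3 (proof of the Theorem)] [cite: Murty1984, §3] -/
theorem rm4Letters_cross_mem_span_rational_oneOne (g : Fin n → (B ⟶ A)) {T : Type*}
    {W : T → Submodule ℂ (ℂ ⊗[ℚ] bettiCohomology A.X 1)} (b : ∀ τ, Module.Basis (Fin 4) ℂ (W τ))
    (hθ : ∀ τ, cupH1 A (b τ 0 : ℂ ⊗[ℚ] bettiCohomology A.X 1) (b τ 2) +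
        cupH1 A (b τ 1 : ℂ ⊗[ℚ] bettiCohomology A.X 1) (b τ 3) ∈
      Submodule.span ℂ {c : complexBetti A.X 2 | IsRationalClass c ∧ IsOfHodgeType A.dim A.X 2 1 1 c})
    (j j' : Fin n) (τ : T) :
    let L : Fin n × T → Fin 4 → complexBetti B.X 1 := fun s a => complexBetti.map (g s.1).hom.hom.hom 1
      (ofRatClassBaseChange (Motives.ComplexPoints A.X) 1 (b s.2 a : ℂ ⊗[ℚ] bettiCohomology A.X 1))
    cupProduct (rfl : 1 + 1 = 2) (L (j, τ) 0) (L (j', τ) 2) + cupProduct (rfl : 1 + 1 = 2) (L (j', τ) 0) (L (j, τ) 2) +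
        (cupProduct (rfl : 1 + 1 = 2) (L (j, τ) 1) (L (j', τ) 3) +
          cupProduct (rfl : 1 + 1 = 2) (L (j', τ) 1) (L (j, τ) 3)) ∈
      Submodule.span ℂ {c : complexBetti B.X 2 | IsRationalClass c ∧ IsOfHodgeType B.dim B.X 2 1 1 c} := by
  intro L
  have hB : IsSmoothProjective B.dim B.X := Motives.AbelianVariety.isSmoothProjective_holds
  have hA : IsSmoothProjective A.dim A.X := Motives.AbelianVariety.isSmoothProjective_holds
  set f : Fin 4 → complexBetti A.X 1 := fun r =>
    ofRatClassBaseChange (Motives.ComplexPoints A.X) 1 (b τ r : ℂ ⊗[ℚ] bettiCohomology A.X 1) with hf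
  set θ : complexBetti A.X 2 := cupProduct (rfl : 1 + 1 = 2) (f 0) (f 2) + cupProduct (rfl : 1 + 1 = 2) (f 1) (f 3)
    with hθdef
  have hθ' : θ ∈ Submodule.span ℂ
      {c : complexBetti A.X 2 | IsRationalClass c ∧ IsOfHodgeType A.dim A.X 2 1 1 c} := by
    have h := hθ τ
    rwa [cupH1_apply, cupH1_apply] at h
  have hpull : ∀ φ : B ⟶ A, complexBetti.map φ.hom.hom.hom 2 θ =
      cupProduct (rfl : 1 + 1 = 2) (complexBetti.map φ.hom.hom.hom 1 (f 0)) (complexBetti.map φ.hom.hom.hom 1 (f 2)) +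
        cupProduct (rfl : 1 + 1 = 2) (complexBetti.map φ.hom.hom.hom 1 (f 1))
          (complexBetti.map φ.hom.hom.hom 1 (f 3)) := fun φ => by
    rw [hθdef, map_add, complexBetti.map_cupProduct, complexBetti.map_cupProduct]
  have hLj : ∀ a : Fin 4, L (j, τ) a = complexBetti.map (g j).hom.hom.hom 1 (f a) := fun a => rfl
  have hLj' : ∀ a : Fin 4, L (j', τ) a = complexBetti.map (g j').hom.hom.hom 1 (f a) := fun a => rfl
  have key : cupProduct (rfl : 1 + 1 = 2) (L (j, τ) 0) (L (j', τ) 2) +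
        cupProduct (rfl : 1 + 1 = 2) (L (j', τ) 0) (L (j, τ) 2) +
        (cupProduct (rfl : 1 + 1 = 2) (L (j, τ) 1) (L (j', τ) 3) +
          cupProduct (rfl : 1 + 1 = 2) (L (j', τ) 1) (L (j, τ) 3)) =
      complexBetti.map (g j + g j').hom.hom.hom 2 θ - complexBetti.map (g j).hom.hom.hom 2 θ -
        complexBetti.map (g j').hom.hom.hom 2 θ := by
    have hadd : ∀ v : complexBetti A.X 1, complexBetti.map (g j + g j').hom.hom.hom 1 v =
        complexBetti.map (g j).hom.hom.hom 1 v + complexBetti.map (g j').hom.hom.hom 1 v :=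
      fun v => complexBetti_map_add_deg_one (g j) (g j') v
    simp only [hLj, hLj', hpull, hadd, map_add, LinearMap.add_apply]
    abel
  rw [key]
  exact Submodule.sub_mem _ (Submodule.sub_mem _ (map_mem_span_rational_oneOne hB hA _ hθ')
    (map_mem_span_rational_oneOne hB hA _ hθ')) (map_mem_span_rational_oneOne hB hA _ hθ')

/-- **The Gram matrix of a Hodge–Darboux block basis, `G = ( 0 I ; -I 0 )`, satisfies `G⁻¹ = -G`.**
[cite: GoodmanWallachGTM255, §2.1.2] -/
theorem gramFour_inv :
    (!![0, 0, 1, 0; 0, 0, 0, 1; -1, 0, 0, 0; 0, -1, 0, 0] : Matrix (Fin 4) (Fin 4) ℂ)⁻¹ =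
      -!![0, 0, 1, 0; 0, 0, 0, 1; -1, 0, 0, 0; 0, -1, 0, 0] := by
  refine Matrix.inv_eq_left_inv ?_
  ext i j
  fin_cases i <;> fin_cases j <;>
    simp [Matrix.mul_apply, Fin.sum_univ_four]

/-- `G` is alternating. [cite: GoodmanWallachGTM255, §2.1.2] -/
theorem gramFour_isAlt :
    (Matrix.toBilin' (!![0, 0, 1, 0; 0, 0, 0, 1; -1, 0, 0, 0; 0, -1, 0, 0] : Matrix (Fin 4) (Fin 4) ℂ)).IsAlt := by
  intro x
  rw [Matrix.toBilin'_apply']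
  simp [Matrix.mulVec, dotProduct, Fin.sum_univ_four]
  ring

/-- `G` is non-degenerate (`det G ≠ 0`). [cite: GoodmanWallachGTM255, §2.1.2] -/
theorem gramFour_nondegenerate :
    (Matrix.toBilin' (!![0, 0, 1, 0; 0, 0, 0, 1; -1, 0, 0, 0; 0, -1, 0, 0] : Matrix (Fin 4) (Fin 4) ℂ)).Nondegenerate := by
  rw [LinearMap.BilinForm.nondegenerate_toBilin'_iff_det_ne_zero]
  have h : (!![0, 0, 1, 0; 0, 0, 0, 1; -1, 0, 0, 0; 0, -1, 0, 0] : Matrix (Fin 4) (Fin 4) ℂ) *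
      (-!![0, 0, 1, 0; 0, 0, 0, 1; -1, 0, 0, 0; 0, -1, 0, 0]) = 1 := by
    ext i j
    fin_cases i <;> fin_cases j <;>
      simp [Matrix.mul_apply, Fin.sum_univ_four]
  intro h0
  have h1 := congrArg Matrix.det h
  rw [Matrix.det_mul, h0, zero_mul, Matrix.det_one] at h1
  exact zero_ne_one h1

/-- **The hypothesis `hcross` of the several-blocks divisor criterion for the letters `g_j^* b_τ a`**: for two
slots `s = (j, τ)`, `s' = (j', τ)` at the same place,
`∑_{a,a'} (G⁻¹)_{a a'} · g_j^* ρ(b_τ a) ⌣ g_{j'}^* ρ(b_τ a') = −(crossed class) ∈ D¹(B) ⊗ ℂ` (`G⁻¹ = -G` pairs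
kind `{0,1}` with kind `{2,3}`; anticommutativity of the cup product in degree one).
[cite: Milne1999LefschetzClasses, §3 Prop. 3.6 (a) and p. 656] [cite: Murty1984, §3] -/
theorem sum_gramFourInv_smul_cup_rm4Letters_mem (g : Fin n → (B ⟶ A)) {T : Type*}
    {W : T → Submodule ℂ (ℂ ⊗[ℚ] bettiCohomology A.X 1)} (b : ∀ τ, Module.Basis (Fin 4) ℂ (W τ))
    (hθ : ∀ τ, cupH1 A (b τ 0 : ℂ ⊗[ℚ] bettiCohomology A.X 1) (b τ 2) +
        cupH1 A (b τ 1 : ℂ ⊗[ℚ] bettiCohomology A.X 1) (b τ 3) ∈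
      Submodule.span ℂ {c : complexBetti A.X 2 | IsRationalClass c ∧ IsOfHodgeType A.dim A.X 2 1 1 c})
    (s s' : Fin n × T) (hss' : s.2 = s'.2) :
    (∑ a : Fin 4, ∑ a' : Fin 4,
        (!![0, 0, 1, 0; 0, 0, 0, 1; -1, 0, 0, 0; 0, -1, 0, 0] : Matrix (Fin 4) (Fin 4) ℂ)⁻¹ a a' •
          cupProduct (rfl : 1 + 1 = 2)
            (complexBetti.map (g s.1).hom.hom.hom 1
              (ofRatClassBaseChange (Motives.ComplexPoints A.X) 1 (b s.2 a : ℂ ⊗[ℚ] bettiCohomology A.X 1)))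
            (complexBetti.map (g s'.1).hom.hom.hom 1
              (ofRatClassBaseChange (Motives.ComplexPoints A.X) 1 (b s'.2 a' : ℂ ⊗[ℚ] bettiCohomology A.X 1)))) ∈
      Submodule.span ℂ {c : complexBetti B.X 2 | IsRationalClass c ∧ IsOfHodgeType B.dim B.X 2 1 1 c} := by
  obtain ⟨j, τ⟩ := s
  obtain ⟨j', τ'⟩ := s'
  dsimp only at hss'
  subst hss'
  set L : Fin n × T → Fin 4 → complexBetti B.X 1 := fun s a => complexBetti.map (g s.1).hom.hom.hom 1
    (ofRatClassBaseChange (Motives.ComplexPoints A.X) 1 (b s.2 a : ℂ ⊗[ℚ] bettiCohomology A.X 1)) with hLdef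
  have hcross := rm4Letters_cross_mem_span_rational_oneOne g b hθ j j' τ
  change cupProduct (rfl : 1 + 1 = 2) (L (j, τ) 0) (L (j', τ) 2) + cupProduct (rfl : 1 + 1 = 2) (L (j', τ) 0) (L (j, τ) 2) +
      (cupProduct (rfl : 1 + 1 = 2) (L (j, τ) 1) (L (j', τ) 3) +
        cupProduct (rfl : 1 + 1 = 2) (L (j', τ) 1) (L (j, τ) 3)) ∈ _ at hcross
  change (∑ a : Fin 4, ∑ a' : Fin 4, (!![0, 0, 1, 0; 0, 0, 0, 1; -1, 0, 0, 0; 0, -1, 0, 0] :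
      Matrix (Fin 4) (Fin 4) ℂ)⁻¹ a a' • cupProduct (rfl : 1 + 1 = 2) (L (j, τ) a) (L (j', τ) a')) ∈ _
  have hgc : ∀ x y : complexBetti B.X 1, cupProduct (rfl : 1 + 1 = 2) y x = -cupProduct (rfl : 1 + 1 = 2) x y :=
    fun x y => by
    rw [cupProduct_gradedComm_holds ℂ (Motives.ComplexPoints B.X) (rfl : 1 + 1 = 2) (rfl : 1 + 1 = 2)]
    norm_num
  rw [gramFour_inv]
  simp only [Fin.sum_univ_four, Matrix.neg_apply, Matrix.of_apply, Matrix.cons_val', Matrix.cons_val_zero,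
    Matrix.cons_val_one, Matrix.cons_val, Matrix.empty_val', Matrix.cons_val_fin_one, neg_zero, zero_smul,
    add_zero, zero_add, neg_smul, one_smul, neg_neg]
  convert Submodule.neg_mem _ hcross using 1
  rw [hgc (L (j', τ) 0) (L (j, τ) 2), hgc (L (j', τ) 1) (L (j, τ) 3)]
  abel

end RM

end Literature.AlgebraicGeometry.HodgeTheory

end
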